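import Summits.HodgeConjecture.CorCM.IrreducibleOddWeightsIndexParityShadowPair
import HarnessLib

/-!
# Index parity, VII: the DIHEDRAL MODEL assembled — odd moment coordinates ⟹ additive; parallel moments ⟹ interaction

COR-CM (cell `pub-hodgecm2`, binder seat `b16` gen 68, count-neutral claim INDEX PARITY, file P6 — abstract `G`-set level;
theorems only, no definition, no named fact, no `sorry`).  NEW as stated, hence under `Summits/`.  HONEST FRAMING: linear
algebra about the Kubota–Dodson rank of a pair of CM types on a MODEL (a linear action of `G` on a plane `V` through which
the shadow translates of both slots factor); which pairs of CM fields realise the model is a finite Galois computation left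
to the user (this generation's census: the towers `K₀ = T₀F`, `K₁ = T₁F′` over the D₄ reflex pair `(T₀, T₁)` of quartic CM
fields); `HC_CM` is neither used nor asserted.

SETTING (P5 `IrreducibleOddWeightsIndexParityShadowPair` §3–§4).  Slots `E_{i₀}, E_{i₁}` with equivariant pivots
`r_κ : E_{i_κ} → Y_κ` refining the trace classes; a linear action `act : G →* End(V)`; equivariant "position" maps
`e_κ : Y_κ → V`; MOMENT FUNCTIONALS `φ_κ ∈ V*` through which the shadows factor: `w_κ(g·y) = φ_κ(act g (e_κ y))`.

* **`typeRank_sigmaType_add_card_eq_of_dihedral_of_odd`** — if the action contains the two dihedral operators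
  (`R : e₁ ↦ e₂ ↦ −e₁`, `S : e₁ ↦ e₁, e₂ ↦ −e₂`, `e₁, e₂` spanning `V`) and the moment coordinates `φ₀(e₁), φ₀(e₂)`,
  `φ₁(e₁+e₂), φ₁(e₁−e₂)` are ODD integers, the pair is ADDITIVE: `rank(Φ₀,Φ₁) + 2 = rank Φ₀ + rank Φ₁ + 1` (P5:
  dihedral separation + 2-adic obstruction + rank-one disjointness).  Over the D₄ reflex pair the coordinates are shadow
  ENTRIES, odd for odd indices (P2): odd × odd indices are additive for ALL types although (PC) fails.
* **`finrank_inf_pos_of_moment_parallel`** / **`typeRank_sigmaType_add_card_lt_of_moment_parallel`** — conversely, if the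
  moments are PARALLEL (`φ₀ = t·φ₁`), some slot-0 position `e₀(y)` lies in the span of the slot-1 positions and its
  coefficient `g ↦ φ₀(act g (e₀ y))` is non-zero, then the two shadow-coefficient spaces MEET and the pair INTERACTS
  (`rank(Φ₀,Φ₁) + 2 < rank Φ₀ + rank Φ₁ + 1`) — in the D₄ model an EVEN index admits the shadow `2(δ_y − δ_ȳ)` with moment
  `(2, 0) ∥ (1+1, 1−1)`: even indices interact (census: defect `2`).

## References

* [Gordon1999HodgeAVSurvey] B. B. Gordon, *A survey of the Hodge conjecture for abelian varieties*, §3 Theorem, 7.5–7.7.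
* [Serre1977] J.-P. Serre, *Linear Representations of Finite Groups*, GTM 42, §2.2, §5.3 (the dihedral groups).
* [Lang2002] S. Lang, *Algebra*, 3rd ed., XVII §3.
* [Shimura1998] G. Shimura, *Abelian Varieties with Complex Multiplication and Modular Functions*, §8.4.
-/

set_option autoImplicit false

noncomputable section

open scoped BigOperators Classical

universe u v v' v'' w

namespace Summit.HodgeConjecture.CorCM.IrrOdd

open Literature.NumberTheory.ComplexMultiplication

variable {G : Type w} [Group G] {V : Type v} [AddCommGroup V] [Module ℚ V]
  {I : Type u} {E : I → Type v} [∀ i, MulAction G (E i)] [∀ i, Fintype (E i)] [Fintype I] [∀ i, Nonempty (E i)]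
  {Y₀ : Type v'} [DecidableEq Y₀] [MulAction G Y₀] {Y₁ : Type v''} [DecidableEq Y₁] [MulAction G Y₁]

/-- **THE DIHEDRAL MODEL, ODD COORDINATES ⟹ ADDITIVE.**  Shadow translates of both slots factoring through moment
functionals of one plane action containing the dihedral operators, with ODD integer coordinates
`φ₀(e₁), φ₀(e₂), φ₁(e₁+e₂), φ₁(e₁−e₂)` ⟹ `rank(Φ₀,Φ₁) + 2 = rank Φ₀ + rank Φ₁ + 1`.
[cite: Gordon1999HodgeAVSurvey, §3 Theorem, 7.5–7.7] [cite: Serre1977, §2.2 and §5.3] -/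
theorem typeRank_sigmaType_add_card_eq_of_dihedral_of_odd {ρ : G} {Φ : ∀ i, Set (E i)}
    (h : ∀ i, IsCMTypeWith ρ (Φ i)) {i₀ i₁ : I} (hI : ∀ j, j = i₀ ∨ j = i₁) (h01 : i₀ ≠ i₁)
    (r₀ : E i₀ → Y₀) (r₁ : E i₁ → Y₁) (hr₀ : ∀ (g : G) (x : E i₀), r₀ (g • x) = g • r₀ x)
    (hr₁ : ∀ (g : G) (x : E i₁), r₁ (g • x) = g • r₁ x)
    (hfine₀ : ∀ x x' : E i₀, r₀ x = r₀ x' → ∃ n : G, (∀ y : E i₁, n • y = y) ∧ n • x = x')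
    (hfine₁ : ∀ x x' : E i₁, r₁ x = r₁ x' → ∃ n : G, (∀ y : E i₀, n • y = y) ∧ n • x = x')
    (act : G →* V →ₗ[ℚ] V) {b₁ b₂ : V} (hspan : ∀ v : V, ∃ x y : ℚ, v = x • b₁ + y • b₂) {gR gS : G}
    (hR₁ : act gR b₁ = b₂) (hR₂ : act gR b₂ = -b₁) (hS₁ : act gS b₁ = b₁) (hS₂ : act gS b₂ = -b₂)
    {φ₀ φ₁ : Module.Dual ℚ V} (e₀ : Y₀ → V) (e₁ : Y₁ → V)
    (hw₀ : ∀ (y : Y₀) (g : G), ∑ x ∈ Finset.univ.filter (fun x => r₀ x = g • y), antiVec (Φ i₀) (1 : G) x =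
      φ₀ (act g (e₀ y)))
    (hw₁ : ∀ (y : Y₁) (g : G), ∑ x ∈ Finset.univ.filter (fun x => r₁ x = g • y), antiVec (Φ i₁) (1 : G) x =
      φ₁ (act g (e₁ y)))
    {α β a b : ℤ} (hα : Odd α) (hβ : Odd β) (ha : Odd a) (hb : Odd b) (h0₁ : φ₀ b₁ = α) (h0₂ : φ₀ b₂ = β)
    (h1₁ : φ₁ (b₁ + b₂) = a) (h1₂ : φ₁ (b₁ - b₂) = b) :
    typeRank G (sigmaType Φ) + Fintype.card I = (∑ i, typeRank G (Φ i)) + 1 :=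
  typeRank_sigmaType_add_card_eq_of_moment_not_parallel h hI h01 r₀ r₁ hr₀ hr₁ hfine₀ hfine₁ act
    (separate_of_dihedral act hspan hR₁ hR₂ hS₁ hS₂)
    (Summit.HodgeConjecture.CorCM.dual_ne_smul_of_odd hα hβ ha hb h0₁ h0₂ h1₁ h1₂) e₀ e₁ hw₀ hw₁

omit [Fintype I] [∀ i, Nonempty (E i)] in
/-- **PARALLEL MOMENTS MEET**: if `φ₀ = t·φ₁`, a slot-0 position `e₀(y)` lies in the span of the slot-1 positions, and
its coefficient `g ↦ φ₀(act g (e₀ y))` is non-zero, then the two shadow-coefficient spaces have a non-zero common element.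
[cite: Serre1977, §2.2] [cite: Gordon1999HodgeAVSurvey, §3 Theorem (proof)] -/
theorem finrank_inf_pos_of_moment_parallel [Finite Y₀] {Φ : ∀ i, Set (E i)} {i₀ i₁ : I} (r₀ : E i₀ → Y₀)
    (r₁ : E i₁ → Y₁)
    (act : G →* V →ₗ[ℚ] V) {φ₀ φ₁ : Module.Dual ℚ V} (e₀ : Y₀ → V) (e₁ : Y₁ → V)
    (hw₀ : ∀ (y : Y₀) (g : G), ∑ x ∈ Finset.univ.filter (fun x => r₀ x = g • y), antiVec (Φ i₀) (1 : G) x =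
      φ₀ (act g (e₀ y)))
    (hw₁ : ∀ (y : Y₁) (g : G), ∑ x ∈ Finset.univ.filter (fun x => r₁ x = g • y), antiVec (Φ i₁) (1 : G) x =
      φ₁ (act g (e₁ y)))
    {t : ℚ} (hpar : φ₀ = t • φ₁) {y : Y₀} (hy : e₀ y ∈ Submodule.span ℚ (Set.range e₁))
    (hne : (fun g : G => φ₀ (act g (e₀ y))) ≠ 0) :
    0 < Module.finrank ℚ (Submodule.span ℚ (Set.range fun y : Y₀ => fun g : G =>
            ∑ x ∈ Finset.univ.filter (fun x => r₀ x = g • y), antiVec (Φ i₀) (1 : G) x) ⊓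
          Submodule.span ℚ (Set.range fun y : Y₁ => fun g : G =>
            ∑ x ∈ Finset.univ.filter (fun x => r₁ x = g • y), antiVec (Φ i₁) (1 : G) x) : Submodule ℚ (G → ℚ)) := by
  -- the candidate common element
  set c : G → ℚ := fun g : G => φ₀ (act g (e₀ y)) with hc
  have hc₀ : c ∈ Submodule.span ℚ (Set.range fun y : Y₀ => fun g : G =>
      ∑ x ∈ Finset.univ.filter (fun x => r₀ x = g • y), antiVec (Φ i₀) (1 : G) x) :=
    Submodule.subset_span ⟨y, funext fun g => hw₀ y g⟩
  -- `c = t · (g ↦ φ₁(act g (e₀ y)))`, and `v ↦ (g ↦ φ₁(act g v))` is linear, so `c` lies in the slot-1 span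
  have hlin : ∀ v ∈ Submodule.span ℚ (Set.range e₁), (fun g : G => φ₁ (act g v)) ∈
      Submodule.span ℚ (Set.range fun y : Y₁ => fun g : G =>
        ∑ x ∈ Finset.univ.filter (fun x => r₁ x = g • y), antiVec (Φ i₁) (1 : G) x) := by
    intro v hv
    induction hv using Submodule.span_induction with
    | mem v hv =>
      obtain ⟨y', rfl⟩ := hv
      exact Submodule.subset_span ⟨y', funext fun g => hw₁ y' g⟩
    | zero =>
      have : (fun g : G => φ₁ (act g (0 : V))) = 0 := funext fun g => by simp
      rw [this]; exact Submodule.zero_mem _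
    | add v v' _ _ hv hv' =>
      have : (fun g : G => φ₁ (act g (v + v'))) = (fun g : G => φ₁ (act g v)) + fun g : G => φ₁ (act g v') :=
        funext fun g => by simp
      rw [this]; exact Submodule.add_mem _ hv hv'
    | smul s v _ hv =>
      have : (fun g : G => φ₁ (act g (s • v))) = s • fun g : G => φ₁ (act g v) := funext fun g => by simp
      rw [this]; exact Submodule.smul_mem _ _ hv
  have hc₁ : c ∈ Submodule.span ℚ (Set.range fun y : Y₁ => fun g : G =>
      ∑ x ∈ Finset.univ.filter (fun x => r₁ x = g • y), antiVec (Φ i₁) (1 : G) x) := by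
    have : c = t • fun g : G => φ₁ (act g (e₀ y)) := by
      funext g; simp [hc, hpar]
    rw [this]
    exact Submodule.smul_mem _ _ (hlin _ hy)
  haveI : Module.Finite ℚ (Submodule.span ℚ (Set.range fun y : Y₀ => fun g : G =>
      ∑ x ∈ Finset.univ.filter (fun x => r₀ x = g • y), antiVec (Φ i₀) (1 : G) x)) :=
    Module.Finite.span_of_finite ℚ (Set.finite_range _)
  haveI : Module.Finite ℚ ↥(Submodule.span ℚ (Set.range fun y : Y₀ => fun g : G =>
            ∑ x ∈ Finset.univ.filter (fun x => r₀ x = g • y), antiVec (Φ i₀) (1 : G) x) ⊓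
          Submodule.span ℚ (Set.range fun y : Y₁ => fun g : G =>
            ∑ x ∈ Finset.univ.filter (fun x => r₁ x = g • y), antiVec (Φ i₁) (1 : G) x)) :=
    Module.Finite.of_injective (Submodule.inclusion inf_le_left) (Submodule.inclusion_injective _)
  refine Module.finrank_pos_iff_exists_ne_zero.2 ⟨⟨c, hc₀, hc₁⟩, ?_⟩
  intro h0
  exact hne (by simpa using congrArg Subtype.val h0)

/-- **PARALLEL MOMENTS ⟹ INTERACTION**: under fine equivariant pivots, parallel moment functionals with a realised,
non-vanishing common position force `rank(Φ₀,Φ₁) + 2 < rank Φ₀ + rank Φ₁ + 1` — `Hg(A₀ × A₁) ≠ Hg(A₀) × Hg(A₁)`.  In the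
D₄ model an even index admits the shadow `2(δ_y − δ_ȳ)` (P2 surjectivity) with moment `(2,0) ∥ (1+1, 1−1)`.
[cite: Gordon1999HodgeAVSurvey, §3 Theorem, 7.5–7.7] [cite: Serre1977, §2.2] -/
theorem typeRank_sigmaType_add_card_lt_of_moment_parallel [Finite Y₀] {ρ : G} {Φ : ∀ i, Set (E i)}
    (h : ∀ i, IsCMTypeWith ρ (Φ i)) {i₀ i₁ : I} (hI : ∀ j, j = i₀ ∨ j = i₁) (h01 : i₀ ≠ i₁)
    (r₀ : E i₀ → Y₀) (r₁ : E i₁ → Y₁) (hr₀ : ∀ (g : G) (x : E i₀), r₀ (g • x) = g • r₀ x)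
    (hr₁ : ∀ (g : G) (x : E i₁), r₁ (g • x) = g • r₁ x)
    (hfine₀ : ∀ x x' : E i₀, r₀ x = r₀ x' → ∃ n : G, (∀ y : E i₁, n • y = y) ∧ n • x = x')
    (hfine₁ : ∀ x x' : E i₁, r₁ x = r₁ x' → ∃ n : G, (∀ y : E i₀, n • y = y) ∧ n • x = x')
    (act : G →* V →ₗ[ℚ] V) {φ₀ φ₁ : Module.Dual ℚ V} (e₀ : Y₀ → V) (e₁ : Y₁ → V)
    (hw₀ : ∀ (y : Y₀) (g : G), ∑ x ∈ Finset.univ.filter (fun x => r₀ x = g • y), antiVec (Φ i₀) (1 : G) x =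
      φ₀ (act g (e₀ y)))
    (hw₁ : ∀ (y : Y₁) (g : G), ∑ x ∈ Finset.univ.filter (fun x => r₁ x = g • y), antiVec (Φ i₁) (1 : G) x =
      φ₁ (act g (e₁ y)))
    {t : ℚ} (hpar : φ₀ = t • φ₁) {y : Y₀} (hy : e₀ y ∈ Submodule.span ℚ (Set.range e₁))
    (hne : (fun g : G => φ₀ (act g (e₀ y))) ≠ 0) :
    typeRank G (sigmaType Φ) + Fintype.card I < (∑ i, typeRank G (Φ i)) + 1 := by
  have hcard : Fintype.card I = 2 := by
    rw [← Finset.card_univ, show (Finset.univ : Finset I) = {i₀, i₁} from Finset.ext fun j => by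
      simpa only [Finset.mem_univ, Finset.mem_insert, Finset.mem_singleton, true_iff] using hI j,
      Finset.card_pair h01]
  have hpair := typeRank_add_typeRank_eq_add_finrank_shadowCoeff_inf_shadowCoeff_of_fine h hI h01 r₀ r₁ hr₀ hr₁
    hfine₀ hfine₁
  have hpos := finrank_inf_pos_of_moment_parallel (Φ := Φ) r₀ r₁ act e₀ e₁ hw₀ hw₁ hpar hy hne
  rw [sum_eq_add_of_pair _ hI h01, hcard]
  omega

end Summit.HodgeConjecture.CorCM.IrrOdd

end
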